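import Literature.AnabelianGeometry.EtaleTheta.SettingModelTateKummerDataFiltration
import Literature.AnabelianGeometry.EtaleTheta.SettingModelTateThetaCusp
import HarnessLib

/-!
# The Tate-sheared stage-2 model WITH A CUSP (R78 F5qc): the KUMMER DATA `KummerData.modelχq′` (row F6q′)

Mochizuki, *The étale theta function …*, Publ. RIMS **45** (2009) [EtTh], §1, Prop. 1.3 / 1.5, PRIMS PDF pp. 21–23
[cite: MochizukiEtTh2009, Prop 1.5 p.23]: the Kummer map `K^× → H¹(G_K, Δ_Θ)`, `log(U)`, `log(Ü)`, `log(U)|_Ÿ = 2·log(Ü)`,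
`F² ⥲ (K^×)^∧`, `F¹/F² = Ẑ · log(U)`.

Layer L2 of the abc-iut cell, R78 cluster (row F6q′, named unheld by abc-iut-w5-d171 at its close, STATUS
2026-08-26T11:08:18Z; seat abc-iut-w5-d181): the TRANSCRIPTION of abc-iut-w5-d171's `SettingModelTateKummerData.lean`
(F6q, `kummerDataχq` over abc-iut-L2-t5's `ThetaSetting.modelχq p i j hj`) to abc-iut-w5-d029's CUSPED variant
`ThetaSetting.modelχq′ p i j hj` (F5qc, `SettingModelTateThetaCusp.lean`) — exactly as `SettingModelChiKummerDataCusp`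
(p435106) transcribes stage 1.  The two records share the carrier `Π^tp_X = Γ ⋊ G_{ℚ_p}` (Tate shear on the
longitude), the augmentation, `toZ`, the coverings `Y_N`/`Z_N` and — definitionally, `thetaKer_curveχq'_eq` — the theta
quotient with its centre `Δ_Θ`; they differ only in the cusp datum.  Hence EVERY field of `kummerCoreχq` serves
verbatim (`kummerCoreχq′`), `kummerDataχq′ := (kummerCoreχq′).toKummerData`, and the non-degeneracy
(`kummerDataχq_logU_ne_one`, w5-d171) and filtration position (`SettingModelTateKummerDataFiltration`, this seat)
transport on the nose: at the cusped stage-2 model — the record of the zoo carrying honest Tate action, the guard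
`IsEtThOrigin`, `hYcl`, open `aug` AND a cusp — `log(U) ≠ 1`, `log(U) ∉ F²`, `log(U)^ℤ ∩ F² = 1`, `log(U) ∈ F¹`.

HONEST FRAMING: SEMI-SYNTHETIC model; consistency/non-vacuity evidence for the typed interface ONLY; `KHat := K^×`
honest sub-object of `(K^×)^∧`; nothing of [EtTh] asserted; no side taken on [IUTchIII] Cor. 3.12.  Class (b)
construction over the frozen interface (no interface clause touched); the only instances are Prop-valued re-keyings
of generic `ThetaSetting` facts at the concrete record (the F5c/F6c/F6q precedent).
-/

noncomputable section

namespace Literature.AnabelianGeometry.EtaleTheta.SettingModel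

open Literature.AnabelianGeometry.SemiGraphs

variable (p : ℕ) [Fact p.Prime] (i j : ℤ) (hj : Even j)

/-! ### Instance keys at the cusped stage-2 record -/

/-- `Δ_Θ(modelχq′) ⊴ (Π^tp_X)^Θ`, keyed on `(modelχq′ p i j hj).DeltaTheta`. [cite: MochizukiEtTh2009, §1 p.12] -/
instance deltaTheta_modelχq'_normal : (ThetaSetting.modelχq' p i j hj).DeltaTheta.Normal :=
  ThetaSetting.deltaTheta_normal _

/-- `Δ_Θ(modelχq′)` is commutative, keyed on `(modelχq′ p i j hj).DeltaTheta`. [cite: MochizukiEtTh2009, §1 p.12] -/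
instance deltaTheta_modelχq'_isMulCommutative : IsMulCommutative (ThetaSetting.modelχq' p i j hj).DeltaTheta :=
  ThetaSetting.deltaTheta_comm _

/-- `Δ_Θ(curveχq′)` is commutative, keyed at the cusped curve's quotient carrier. [cite: MochizukiEtTh2009, §1 p.12] -/
instance deltaThetaχq'_isMulCommutative : IsMulCommutative (CurveTheta.thetaToEll (curveχq' p i j)).ker :=
  ⟨⟨fun a b => Subtype.ext (CurveTheta.ker_thetaToEll_comm (curveχq' p i j) a a.2 b b.2)⟩⟩

/-! ### The Kummer core and Kummer data of the cusped stage-2 model -/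

/-- **The Kummer core of the cusped stage-2 model** — field-by-field the core of `modelχq` (same theta quotient,
same `Δ_Θ`-coordinates, same `y`-coordinate kit classes). [cite: MochizukiEtTh2009, Prop 1.5 p.23] -/
def kummerCoreχq' : (ThetaSetting.modelχq' p i j hj).KummerCore where
  augTheta := (kummerCoreχq p i j hj).augTheta
  continuous_augTheta := (kummerCoreχq p i j hj).continuous_augTheta
  augTheta_toTheta := (kummerCoreχq p i j hj).augTheta_toTheta
  coeffHom := (kummerCoreχq p i j hj).coeffHom
  continuous_coeffHom := (kummerCoreχq p i j hj).continuous_coeffHom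
  coeffHom_smul := (kummerCoreχq p i j hj).coeffHom_smul
  bijective_coeffHom := (kummerCoreχq p i j hj).bijective_coeffHom
  map_augTheta_gtpY := (kummerCoreχq p i j hj).map_augTheta_gtpY
  map_augTheta_gtpYdd := (kummerCoreχq p i j hj).map_augTheta_gtpYdd
  finiteDimensional_Kdd := (kummerCoreχq p i j hj).finiteDimensional_Kdd
  logU := (kummerCoreχq p i j hj).logU
  logUdd := (kummerCoreχq p i j hj).logUdd
  res_logU := (kummerCoreχq p i j hj).res_logU

/-- The cusped core has the same `(Π^tp_X)^Θ → G_{ℚ_p}` (= `CurveTheta.augTheta (curveχq′ p i j)`, definitionally).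
[cite: MochizukiEtTh2009, §1 p.12] -/
theorem kummerCoreχq'_augTheta :
    (kummerCoreχq' p i j hj).augTheta = CurveTheta.augTheta (curveχq' p i j) := rfl

/-- **The Kummer data of the cusped stage-2 model.** [cite: MochizukiEtTh2009, Prop 1.5 p.23] -/
def kummerDataχq' : (ThetaSetting.modelχq' p i j hj).KummerData := (kummerCoreχq' p i j hj).toKummerData

/-- `KummerData(modelχq′)` is inhabited — Kummer data at a stage-2 setting with `IsEtThOrigin` AND a cusp.
[cite: MochizukiEtTh2009, Prop 1.5 p.23] -/
theorem nonempty_kummerData_modelχq' : Nonempty (ThetaSetting.modelχq' p i j hj).KummerData :=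
  ⟨kummerDataχq' p i j hj⟩

/-- Its Kummer map is the tree's continuous Kummer map with coefficients `Λ(ℚ̄_p^×) ≅ Ẑ ≅ Δ_Θ`.
[cite: MochizukiEtTh2009, Prop 1.5 p.23] -/
theorem kummerDataχq'_kumY (x : (kummerCoreχq' p i j hj).invY) :
    (kummerDataχq' p i j hj).kumY x =
      (letI := (ThetaSetting.modelχq' p i j hj).unitsAction (kummerCoreχq' p i j hj).augTheta
       (kummerCoreχq' p i j hj).coeff.kummerContMap _ (kummerCoreχq' p i j hj).isOpen_stabilizer' x) :=
  rfl

/-- The cusped Kummer data agree with F6q's on `kumY` (same carrier, same maps — definitionally).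
[cite: MochizukiEtTh2009, Prop 1.5 p.23] -/
theorem kummerDataχq'_kumY_eq (x : (kummerCoreχq' p i j hj).invY) :
    (kummerDataχq' p i j hj).kumY x = (kummerDataχq p i j hj).kumY x := rfl

/-- … and on `log(U)`. [cite: MochizukiEtTh2009, Prop 1.5 p.23] -/
theorem kummerDataχq'_logU_eq : (kummerDataχq' p i j hj).logU = (kummerDataχq p i j hj).logU := rfl

/-! ### Non-degeneracy and filtration position at the cusped stage-2 model (transported) -/

/-- **`log(U) ≠ 0`** at `modelχq′` (w5-d171's stage-2 non-degeneracy, transported). [cite: MochizukiEtTh2009, Prop 1.5 p.23] -/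
theorem kummerDataχq'_logU_ne_one : (kummerDataχq' p i j hj).logU ≠ 1 :=
  kummerDataχq_logU_ne_one p i j hj

/-- **`log(U) ∉ F² = Im(kumY)`** at `modelχq′`. [cite: MochizukiEtTh2009, Prop 1.5 p.23] -/
theorem kummerDataχq'_logU_not_mem_range_kumY :
    (kummerDataχq' p i j hj).logU ∉ Set.range (kummerDataχq' p i j hj).kumY :=
  kummerDataχq_logU_not_mem_range_kumY p i j hj

/-- **`log(U)^ℤ ∩ F² = 1`** at `modelχq′`. [cite: MochizukiEtTh2009, Prop 1.5 p.23] -/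
theorem kummerDataχq'_zpowers_logU_inf_range_kumY :
    Subgroup.zpowers (kummerDataχq' p i j hj).logU ⊓ (kummerDataχq' p i j hj).kumY.range = ⊥ :=
  kummerDataχq_zpowers_logU_inf_range_kumY p i j hj

/-- `Δ_Θ ≤ (Π^tp_Y)^Θ` at `modelχq′`. [cite: MochizukiEtTh2009, §1 p.13] -/
theorem deltaTheta_le_gtpY_map_modelχq' :
    (ThetaSetting.modelχq' p i j hj).DeltaTheta ≤
      (ThetaSetting.modelχq' p i j hj).GtpY.map (ThetaSetting.modelχq' p i j hj).toTheta :=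
  deltaTheta_le_gtpY_map_modelχq p i j hj

/-- **`log(U)|_{Δ_Θ} = 1`** at `modelχq′`: `log(U) ∈ F¹`. [cite: MochizukiEtTh2009, Prop 1.5 p.23] -/
theorem kummerDataχq'_res_deltaTheta_logU :
    ContH1.res (MonoidHom.id (ThetaSetting.modelχq' p i j hj).GtpTheta) (ThetaSetting.modelχq' p i j hj).DeltaTheta
      (deltaTheta_le_gtpY_map_modelχq' p i j hj) (kummerDataχq' p i j hj).logU = 1 :=
  kummerDataχq_res_deltaTheta_logU p i j hj

include i j hj in
/-- **Joint non-vacuity at the cusped stage-2 model**: a theta setting with `IsEtThOrigin` AND a cusp carrying Kummer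
data whose `log(U)` is non-trivial and NOT a Kummer class of a constant. [cite: MochizukiEtTh2009, Prop 1.5 p.23] -/
theorem _root_.Literature.AnabelianGeometry.EtaleTheta.ThetaSetting.exists_isEtThOrigin_and_isCusp_and_kummerData_logU :
    ∃ D : ThetaSetting p, D.IsEtThOrigin ∧ (∃ x : D.Pt, D.IsCusp x) ∧
      ∃ k : D.KummerData, k.logU ≠ 1 ∧ k.logU ∉ Set.range k.kumY :=
  ⟨ThetaSetting.modelχq' p i j hj, ThetaSetting.modelχq'_isEtThOrigin p i j hj, exists_isCusp_modelχq' p i j hj,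
    kummerDataχq' p i j hj, kummerDataχq'_logU_ne_one p i j hj, kummerDataχq'_logU_not_mem_range_kumY p i j hj⟩

end Literature.AnabelianGeometry.EtaleTheta.SettingModel

end
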